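import Summits.QuantumFields.GaugeBoot.FrameTwoDimLinkRP
import Summits.QuantumFields.GaugeBoot.CubicTorusLinkRPNegativeBeta
import Summits.QuantumFields.GaugeBoot.CubicTorusWilsonLoopBetaFlip
import HarnessLib

/-!
# Link reflection positivity of the two-dimensional even torus at EVERY real `β` (gauge-boot, L3 positive supplement; link reflection in two dimensions at every `β`, part 4)

HONEST FRAMING (cell `pub-gaugeboot`, page 1 of every file): the venture produces certified bounds
on lattice expectations at stated coupling, gauge group, dimension and torus size; NOT a mass gap,
NOT a continuum limit, NOT a string tension; NOT Yang–Mills-summit-bearing (barriers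
`FixedCouplingUltralocality`, `PerturbativeInvisibility`). A structural POSITIVE result about the
reflections of a two-dimensional torus; it bounds no expectation of the venture's tables.

`CubicTorusRP.lean` proved link-hyperplane (mid-plane) reflection positivity of the torus Wilson
measure `wilsonMeasure ρ β` on `(ℤ/2Q)^d`, `Q ≥ 2`, along every axis for `β ≥ 0`;
`CubicTorusLinkRPAnyBeta.lean` removed the sign condition for groups with a central involution
represented by `-1` (`SU(2)`, `SU(2n)`, `U(N)`); `CubicTorusLinkRPNegativeBeta.lean` showed that for
`SU(3)` with THREE distinct axes available (`d ≥ 3`) the sign condition is exact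
(`cubicTorus_linkRP_su3_iff`: link RP `⇔ 0 ≤ β`). This module closes the table in TWO dimensions:

* `IsTwoDimFrame.linkRP_sum_mul_conj_integral_nonneg` — the link RP blocks of any two-dimensional
  site frame are positive semidefinite at every real `β` (from `FrameTwoDimLinkRP.lean`);
* `isTwoDimFrame_cubicTorus` — with two directions (`∀ n, n = k ∨ n = l`, `k ≠ l`; e.g. `d = 2`) the
  even torus `(ℤ/2Q)^d` carries a two-dimensional site frame along `k` (`FrameTwoDimAnnulus.lean`;
  transverse period `2Q`);
* **`cubicTorus_linkRP_twoDim`** — for EVERY compact second countable `G`, every continuous `ρ`, EVERY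
  real `β` and every bounded measurable observable `F` of `{1 ≤ x_k ≤ Q}`:
  `0 ≤ ∫ conj F(ΘU) · F(U) dμ_β`; `cubicTorus_linkRP_twoDim_blocks_nonneg` (the blocks);
  `cubicTorus_linkRP_twoDim_suN`, `cubicTorus_linkRP_twoDim_uN` (the venture's gauge groups, every `N`),
  `cubicTorus_linkRP_fin_two` (literally `d = 2`);
* **`cubicTorus_linkRP_su3_iff_twoDim`** — the SHARP statement for `SU(3)` on `(ℤ/2Q)^d`, `Q ≥ 2`,
  with a second axis `l ≠ k`: link reflection positivity along `k` holds for all bounded measurable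
  half observables **iff `0 ≤ β` or the torus is two-dimensional** (`∀ n, n = k ∨ n = l`).

Mechanism (`FrameTwoDimLinkRP.lean`): in two dimensions the crossing plaquettes form two closed
annuli of `2Q` plaquettes; Migdal's recursion turns each into the class-averaged convolution SQUARE
`k_ψ`, `ψ = ω_β^{⋆Q}`, a kernel of positive type whatever the signs of the Fourier coefficients of
`ω_β` — the cycle transfer operator of two-dimensional Yang–Mills is positive at every real `β`. In
`d ≥ 3` the transfer operator of `SU(3)` at `β < 0` is not (baryonic theta graph, odd number of links).

Honest scope: structural; bounds no expectation; no certificate of the cell sits at `β < 0`;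
two-dimensional lattice Yang–Mills is exactly solvable (Migdal, Gross–Witten) and is not a target of the
venture's tables. Small new positive result; mechanism folklore (Migdal 1975, Osterwalder–Seiler 1978).

References: A. A. Migdal, Sov. Phys. JETP 42 (1975) 413; K. Osterwalder, E. Seiler, Ann. Phys. 110
(1978) 440, §2; D. J. Gross, E. Witten, Phys. Rev. D 21 (1980) 446; I. Montvay, G. Münster, Quantum
Fields on a Lattice (1994) pp. 180–185; V. Kazakov, Z. Zheng, arXiv:2203.11360 §3.1.
-/

noncomputable section

open MeasureTheory Complex
open scoped ComplexOrder ComplexConjugate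
open Literature.MathematicalPhysics.QuantumFieldTheory (Site GaugeConfig wilsonMeasure)
open Literature.MathematicalPhysics.QuantumLattice (fundamentalRep unitaryFundamentalRep
  continuous_fundamentalRep continuous_unitaryFundamentalRep)

namespace Summit.QuantumFields.GaugeBoot

namespace TiltedRP

/-! ## The blocks of a two-dimensional site frame -/

namespace IsTwoDimFrame

variable {A : Type*} [AddCommGroup A] [Fintype A] [DecidableEq A] {d : ℕ}
variable {e : Fin d → A} {k l : Fin d} {σ : A →+ A} {Q : ℕ} {h : A →+ ZMod (2 * Q)} {m : ℕ}
variable (hT : IsTwoDimFrame e k l σ Q h m)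
variable {N : ℕ} {G : Type*} [Group G] [TopologicalSpace G] [IsTopologicalGroup G] [CompactSpace G]
  [MeasurableSpace G] [BorelSpace G] [SecondCountableTopology G]
variable (ρ : G →* Matrix (Fin N) (Fin N) ℂ)
include hT

/-- **The two-dimensional link RP blocks are positive semidefinite at every real `β`**: for bounded
measurable half-space observables `F_1, …, F_n` and `c ∈ ℂ^n`,
`0 ≤ ∑_{a,b} conj c_a · c_b · ∫ conj(F_a(ΘU)) F_b(U) dμ_β`. -/
theorem linkRP_sum_mul_conj_integral_nonneg (hρ : Continuous ρ) (β : ℝ) {n : ℕ}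
    (F : Fin n → Config A d G → ℂ) (hFm : ∀ a, Measurable (F a))
    (hFb : ∀ a, ∃ C : ℝ, ∀ U, ‖F a U‖ ≤ C) (hFo : ∀ a, IsMidObservable e Q h (F a)) (c : Fin n → ℂ) :
    0 ≤ ∑ a, ∑ b, conj (c a) * c b *
      ∫ U, conj (F a (configMidReflect e k σ U)) * F b U ∂(gibbs ρ e β) := by
  haveI := isProbabilityMeasure_gibbs (A := A) (G := G) ρ hρ e β
  set H : Config A d G → ℂ := fun U => ∑ b, c b * F b U with hH
  have hHm : Measurable H := Finset.measurable_sum _ fun b _ => (hFm b).const_mul _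
  choose C hC using hFb
  have hHb : ∃ K : ℝ, ∀ U, ‖H U‖ ≤ K := ⟨∑ b, ‖c b‖ * C b, fun U =>
    (norm_sum_le _ _).trans (Finset.sum_le_sum fun b _ => by
      rw [norm_mul]; exact mul_le_mul_of_nonneg_left (hC b U) (norm_nonneg _))⟩
  have hHo : IsMidObservable e Q h H := fun U V hUV => by
    simp only [hH]
    exact Finset.sum_congr rfl fun b _ => by rw [hFo b U V hUV]
  have key := hT.linkRP_integral_conj_mul_nonneg ρ hρ β H hHm hHb hHo
  have hint : ∀ a b, Integrable (fun U => conj (F a (configMidReflect e k σ U)) * F b U)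
      (gibbs ρ e β) :=
    fun a b => Integrable.of_bound
      (((Complex.continuous_conj.measurable.comp ((hFm a).comp
        (IsSiteFrame.measurable_configMidReflect (e := e) (k := k) (σ := σ)))).mul
        (hFm b)).aestronglyMeasurable) (C a * C b) (ae_of_all _ fun U => by
        rw [norm_mul, Complex.norm_conj]
        exact mul_le_mul (hC a _) (hC b U) (norm_nonneg _) ((norm_nonneg (F a U)).trans (hC a U)))
  have hexp : ∫ U, conj (H (configMidReflect e k σ U)) * H U ∂(gibbs ρ e β) =
      ∑ a, ∑ b, conj (c a) * c b *
        ∫ U, conj (F a (configMidReflect e k σ U)) * F b U ∂(gibbs ρ e β) := by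
    have h1 : ∀ U, conj (H (configMidReflect e k σ U)) * H U =
        ∑ a, ∑ b, conj (c a) * c b * (conj (F a (configMidReflect e k σ U)) * F b U) := fun U => by
      simp only [hH, map_sum, map_mul]
      rw [Finset.sum_mul_sum]
      exact Finset.sum_congr rfl fun a _ => Finset.sum_congr rfl fun b _ => by ring
    simp_rw [h1]
    rw [integral_finsetSum _ fun a _ => integrable_finsetSum _ fun b _ => (hint a b).const_mul _]
    refine Finset.sum_congr rfl fun a _ => ?_
    rw [integral_finsetSum _ fun b _ => (hint a b).const_mul _]
    exact Finset.sum_congr rfl fun b _ => integral_const_mul _ _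
  rwa [hexp] at key

end IsTwoDimFrame

/-! ## The two-dimensional site frame of the even torus -/

section Frame

variable {d : ℕ}

/-- With two directions every site of `(ℤ/L)^d` is `x_k • e_k + x_l • e_l`. [folklore] -/
theorem cubicTorus_eq_nsmul_add_nsmul {L : ℕ} [NeZero L] {k l : Fin d} (hkl : k ≠ l)
    (hd : ∀ n : Fin d, n = k ∨ n = l) (y : Site d L) :
    y = (y k).val • cubicUnit d L k + (y l).val • cubicUnit d L l := by
  funext n
  simp only [Pi.add_apply, nsmul_cubicUnit, Pi.single_apply, ZMod.natCast_zmod_val]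
  rcases hd n with rfl | rfl
  · rw [if_pos rfl, if_neg hkl, add_zero]
  · rw [if_neg (Ne.symm hkl), if_pos rfl, zero_add]

/-- `n • e_l = 0` in `(ℤ/L)^d` iff `L ∣ n`. [folklore] -/
theorem nsmul_cubicUnit_eq_zero_iff {L : ℕ} (l : Fin d) (n : ℕ) :
    n • cubicUnit d L l = 0 ↔ L ∣ n := by
  rw [nsmul_cubicUnit]
  constructor
  · intro h0
    have h1 := congrFun h0 l
    rw [Pi.single_eq_same, Pi.zero_apply] at h1
    exact (ZMod.natCast_eq_zero_iff _ _).1 h1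
  · intro hdvd
    rw [(ZMod.natCast_eq_zero_iff _ _).2 hdvd, Pi.single_zero]

/-- The unit vectors of `(ℤ/L)^d` have additive order `L`. [folklore] -/
theorem addOrderOf_cubicUnit {L : ℕ} (l : Fin d) : addOrderOf (cubicUnit d L l) = L :=
  Nat.dvd_antisymm (addOrderOf_dvd_of_nsmul_eq_zero ((nsmul_cubicUnit_eq_zero_iff l L).2 dvd_rfl))
    ((nsmul_cubicUnit_eq_zero_iff l _).1 (addOrderOf_nsmul_eq_zero _))

/-- **The even torus with two directions carries a two-dimensional site frame along each axis**:
`(ℤ/2Q)^d`, `Q ≥ 2`, directions `k ≠ l` with `∀ n, n = k ∨ n = l`; reflection `x_k ↦ -x_k`, height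
`x_k`, transverse period `2Q`. -/
theorem isTwoDimFrame_cubicTorus {Q : ℕ} (hQ : 2 ≤ Q) {k l : Fin d} (hkl : k ≠ l)
    (hd : ∀ n : Fin d, n = k ∨ n = l) :
    IsTwoDimFrame (cubicUnit d (2 * Q)) k l (cubicAxisReflect d (2 * Q) k) Q
      (cubicAxisCoord d (2 * Q) k) Q where
  toIsSiteFrame := isSiteFrame_cubicTorus d hQ k
  ne := fun h => hkl h.symm
  dirs := hd
  gen y := by
    haveI : NeZero (2 * Q) := ⟨by omega⟩
    exact ⟨(y k).val, (y l).val, cubicTorus_eq_nsmul_add_nsmul hkl hd y⟩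
  one_le := by omega
  addOrderOf_eq := addOrderOf_cubicUnit l

end Frame

/-! ## Link reflection positivity of the two-dimensional even torus at every real `β` -/

section Torus

variable {d Q N : ℕ} [NeZero Q]
variable {G : Type} [Group G] [TopologicalSpace G] [IsTopologicalGroup G] [CompactSpace G]
  [MeasurableSpace G] [BorelSpace G] [SecondCountableTopology G]
variable (ρ : G →* Matrix (Fin N) (Fin N) ℂ)

/-- **Link-hyperplane reflection positivity of the two-dimensional torus Wilson measure at EVERY
real `β`.** On the even torus `(ℤ/2Q)^d`, `Q ≥ 2`, with two directions (`k ≠ l`,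
`∀ n, n = k ∨ n = l`), for a compact second countable `G`, a continuous `ρ`, EVERY real `β` and every
bounded measurable `F` depending only on the links with both endpoints in `{1 ≤ x_k ≤ Q}`:
`0 ≤ ∫ conj F(ΘU) · F(U) dμ_β(U)`, `μ_β = wilsonMeasure ρ β`, `Θ` the reflection in the line
`x_k = ½`. (With a third axis this fails for `SU(3)` at every `β < 0`: `not_cubicTorus_linkRP_su3`.) -/
theorem cubicTorus_linkRP_twoDim (hQ : 2 ≤ Q) {k l : Fin d} (hkl : k ≠ l)
    (hd : ∀ n : Fin d, n = k ∨ n = l) (hρ : Continuous ρ) (β : ℝ)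
    (F : GaugeConfig d (2 * Q) G → ℂ) (hFm : Measurable F) (hFb : ∃ C : ℝ, ∀ U, ‖F U‖ ≤ C)
    (hFo : IsMidObservable (cubicUnit d (2 * Q)) Q (cubicAxisCoord d (2 * Q) k) F) :
    0 ≤ ∫ U, conj (F (configMidReflect (cubicUnit d (2 * Q)) k (cubicAxisReflect d (2 * Q) k) U)) *
      F U ∂(wilsonMeasure (d := d) (L := 2 * Q) ρ β) := by
  rw [← gibbs_cubicUnit_eq_wilsonMeasure ρ hρ β]
  exact (isTwoDimFrame_cubicTorus hQ hkl hd).linkRP_integral_conj_mul_nonneg ρ hρ β F hFm hFb hFo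

/-- **The link RP blocks of the two-dimensional torus are positive semidefinite at every real `β`**:
for bounded measurable observables `F_1, …, F_n` of `{1 ≤ x_k ≤ Q}` and `c ∈ ℂ^n`,
`0 ≤ ∑_{a,b} conj c_a · c_b · ⟨conj(F_a ∘ Θ) F_b⟩_β` — the link reflection-positivity blocks of a
two-dimensional torus bootstrap are sign-free constraints for every gauge group. -/
theorem cubicTorus_linkRP_twoDim_blocks_nonneg (hQ : 2 ≤ Q) {k l : Fin d} (hkl : k ≠ l)
    (hd : ∀ n : Fin d, n = k ∨ n = l) (hρ : Continuous ρ) (β : ℝ) {n : ℕ}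
    (F : Fin n → GaugeConfig d (2 * Q) G → ℂ) (hFm : ∀ a, Measurable (F a))
    (hFb : ∀ a, ∃ C : ℝ, ∀ U, ‖F a U‖ ≤ C)
    (hFo : ∀ a, IsMidObservable (cubicUnit d (2 * Q)) Q (cubicAxisCoord d (2 * Q) k) (F a))
    (c : Fin n → ℂ) :
    0 ≤ ∑ a, ∑ b, conj (c a) * c b *
      ∫ U, conj (F a (configMidReflect (cubicUnit d (2 * Q)) k (cubicAxisReflect d (2 * Q) k) U)) *
        F b U ∂(wilsonMeasure (d := d) (L := 2 * Q) ρ β) := by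
  rw [← gibbs_cubicUnit_eq_wilsonMeasure ρ hρ β]
  exact (isTwoDimFrame_cubicTorus hQ hkl hd).linkRP_sum_mul_conj_integral_nonneg ρ hρ β F hFm hFb hFo c

/-- **Literally `d = 2`**: on `(ℤ/2Q)^2`, `Q ≥ 2`, link reflection positivity along either axis `k`
holds at EVERY real `β` for every compact second countable `G` and continuous `ρ`. -/
theorem cubicTorus_linkRP_fin_two (hQ : 2 ≤ Q) (k : Fin 2) (hρ : Continuous ρ) (β : ℝ)
    (F : GaugeConfig 2 (2 * Q) G → ℂ) (hFm : Measurable F) (hFb : ∃ C : ℝ, ∀ U, ‖F U‖ ≤ C)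
    (hFo : IsMidObservable (cubicUnit 2 (2 * Q)) Q (cubicAxisCoord 2 (2 * Q) k) F) :
    0 ≤ ∫ U, conj (F (configMidReflect (cubicUnit 2 (2 * Q)) k (cubicAxisReflect 2 (2 * Q) k) U)) *
      F U ∂(wilsonMeasure (d := 2) (L := 2 * Q) ρ β) := by
  have hk : k = 0 ∨ k = 1 := by fin_cases k <;> simp
  rcases hk with rfl | rfl
  · exact cubicTorus_linkRP_twoDim ρ hQ (k := 0) (l := 1) (by decide)
      (fun n => by fin_cases n <;> simp) hρ β F hFm hFb hFo
  · exact cubicTorus_linkRP_twoDim ρ hQ (k := 1) (l := 0) (by decide)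
      (fun n => by fin_cases n <;> simp) hρ β F hFm hFb hFo

/-! ## The venture's gauge groups -/

/-- **Link RP of two-dimensional `SU(N)` lattice Yang–Mills on the even torus at EVERY real `β`**
(fundamental representation, Wilson action; `(ℤ/2Q)^d` with two directions, `Q ≥ 2`; every `N` —
`SU(3)` included, in contrast with `d ≥ 3`). -/
theorem cubicTorus_linkRP_twoDim_suN (hQ : 2 ≤ Q) {k l : Fin d} (hkl : k ≠ l)
    (hd : ∀ n : Fin d, n = k ∨ n = l) (β : ℝ)
    (F : GaugeConfig d (2 * Q) (Matrix.specialUnitaryGroup (Fin N) ℂ) → ℂ) (hFm : Measurable F)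
    (hFb : ∃ C : ℝ, ∀ U, ‖F U‖ ≤ C)
    (hFo : IsMidObservable (cubicUnit d (2 * Q)) Q (cubicAxisCoord d (2 * Q) k) F) :
    0 ≤ ∫ U, conj (F (configMidReflect (cubicUnit d (2 * Q)) k (cubicAxisReflect d (2 * Q) k) U)) *
      F U ∂(wilsonMeasure (d := d) (L := 2 * Q) (fundamentalRep (Fin N)) β) := by
  haveI : SecondCountableTopology (Matrix (Fin N) (Fin N) ℂ) :=
    inferInstanceAs (SecondCountableTopology (Fin N → Fin N → ℂ))
  haveI : SecondCountableTopology (Matrix.specialUnitaryGroup (Fin N) ℂ) :=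
    Topology.IsEmbedding.subtypeVal.secondCountableTopology
  exact cubicTorus_linkRP_twoDim (fundamentalRep (Fin N)) hQ hkl hd (continuous_fundamentalRep (Fin N))
    β F hFm hFb hFo

/-- **Link RP of two-dimensional `U(N)` lattice gauge theory on the even torus at EVERY real `β`**
(fundamental representation; two directions, `Q ≥ 2`; every `N`, `U(1)` included). -/
theorem cubicTorus_linkRP_twoDim_uN (hQ : 2 ≤ Q) {k l : Fin d} (hkl : k ≠ l)
    (hd : ∀ n : Fin d, n = k ∨ n = l) (β : ℝ)
    (F : GaugeConfig d (2 * Q) (Matrix.unitaryGroup (Fin N) ℂ) → ℂ) (hFm : Measurable F)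
    (hFb : ∃ C : ℝ, ∀ U, ‖F U‖ ≤ C)
    (hFo : IsMidObservable (cubicUnit d (2 * Q)) Q (cubicAxisCoord d (2 * Q) k) F) :
    0 ≤ ∫ U, conj (F (configMidReflect (cubicUnit d (2 * Q)) k (cubicAxisReflect d (2 * Q) k) U)) *
      F U ∂(wilsonMeasure (d := d) (L := 2 * Q) (unitaryFundamentalRep (Fin N) ℂ) β) := by
  haveI : SecondCountableTopology (Matrix (Fin N) (Fin N) ℂ) :=
    inferInstanceAs (SecondCountableTopology (Fin N → Fin N → ℂ))
  haveI : SecondCountableTopology (Matrix.unitaryGroup (Fin N) ℂ) :=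
    Topology.IsEmbedding.subtypeVal.secondCountableTopology
  exact cubicTorus_linkRP_twoDim (unitaryFundamentalRep (Fin N) ℂ) hQ hkl hd
    (continuous_unitaryFundamentalRep (n := Fin N) (𝕜 := ℂ)) β F hFm hFb hFo

/-! ## The sharp statement for `SU(3)`: `0 ≤ β` or two dimensions -/

/-- **`SU(3)` LINK REFLECTION POSITIVITY ON THE EVEN TORUS: EXACTLY `0 ≤ β` OR TWO DIMENSIONS.** On
`(ℤ/2Q)^d`, `Q ≥ 2`, with a second axis `l ≠ k`, closed-half link reflection positivity along `k` of
`SU(3)` lattice Yang–Mills (`wilsonMeasure (fundamentalRep (Fin 3)) β`) holds for ALL bounded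
measurable observables of `{1 ≤ x_k ≤ Q}` if and only if `0 ≤ β` OR `k, l` are the only directions.
(`⇐`: `cubicTorus_linkRP_suN` for `0 ≤ β`, `cubicTorus_linkRP_twoDim_suN` in two dimensions; `⇒`: a
third axis `m` and `β < 0` give the baryonic theta witness of `cubicTorus_linkRP_su3_neg`.) -/
theorem cubicTorus_linkRP_su3_iff_twoDim (hQ : 2 ≤ Q) {k l : Fin d} (hkl : k ≠ l) (β : ℝ) :
    (∀ F : GaugeConfig d (2 * Q) (Matrix.specialUnitaryGroup (Fin 3) ℂ) → ℂ, Measurable F →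
        (∃ C : ℝ, ∀ U, ‖F U‖ ≤ C) →
        IsMidObservable (cubicUnit d (2 * Q)) Q (cubicAxisCoord d (2 * Q) k) F →
        0 ≤ ∫ U, conj (F (configMidReflect (cubicUnit d (2 * Q)) k (cubicAxisReflect d (2 * Q) k) U)) *
          F U ∂(wilsonMeasure (d := d) (L := 2 * Q) (fundamentalRep (Fin 3)) β)) ↔
      (0 ≤ β ∨ ∀ n : Fin d, n = k ∨ n = l) := by
  constructor
  · intro hall
    by_cases hβ : 0 ≤ β
    · exact Or.inl hβ
    · refine Or.inr fun n => ?_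
      by_contra hn
      have hnk : n ≠ k := fun h => hn (Or.inl h)
      have hnl : n ≠ l := fun h => hn (Or.inr h)
      exact not_cubicTorus_linkRP_su3 hQ (k := k) (l := l) (m := n) (fun h => hkl h.symm) hnk
        (fun h => hnl h.symm) (not_le.1 hβ) hall
  · rintro (hβ | hd) F hFm hFb hFo
    · exact cubicTorus_linkRP_suN hQ k hβ F hFm hFb hFo
    · exact cubicTorus_linkRP_twoDim_suN hQ hkl hd β F hFm hFb hFo

/-- **In two dimensions the `SU(3)` failure of `d ≥ 3` is absent**: on `(ℤ/2Q)^2`, `Q ≥ 2`, either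
axis, EVERY real `β` (in particular every `β < 0`), every bounded measurable half observable has a
non-negative reflection pairing — whereas on `(ℤ/2Q)^d` with three distinct axes and `β < 0` some half
observable has a negative one (`cubicTorus_linkRP_su3_neg`). -/
theorem cubicTorus_linkRP_su3_fin_two (hQ : 2 ≤ Q) (k : Fin 2) (β : ℝ)
    (F : GaugeConfig 2 (2 * Q) (Matrix.specialUnitaryGroup (Fin 3) ℂ) → ℂ) (hFm : Measurable F)
    (hFb : ∃ C : ℝ, ∀ U, ‖F U‖ ≤ C)
    (hFo : IsMidObservable (cubicUnit 2 (2 * Q)) Q (cubicAxisCoord 2 (2 * Q) k) F) :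
    0 ≤ ∫ U, conj (F (configMidReflect (cubicUnit 2 (2 * Q)) k (cubicAxisReflect 2 (2 * Q) k) U)) *
      F U ∂(wilsonMeasure (d := 2) (L := 2 * Q) (fundamentalRep (Fin 3)) β) := by
  haveI : SecondCountableTopology (Matrix (Fin 3) (Fin 3) ℂ) :=
    inferInstanceAs (SecondCountableTopology (Fin 3 → Fin 3 → ℂ))
  haveI : SecondCountableTopology (Matrix.specialUnitaryGroup (Fin 3) ℂ) :=
    Topology.IsEmbedding.subtypeVal.secondCountableTopology
  exact cubicTorus_linkRP_fin_two (fundamentalRep (Fin 3)) hQ k (continuous_fundamentalRep (Fin 3)) β F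
    hFm hFb hFo

end Torus

end TiltedRP

end Summit.QuantumFields.GaugeBoot

end
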